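import Literature.NumberTheory.Sieve.ParityWave0
import Literature.NumberTheory.Sieve.MaynardTao
import Literature.NumberTheory.Sieve.ParityWave0Proofs
import HarnessLib

/-!
# Bounded gaps in `m`-tuples of primes (parity.S13): the assembly of Maynard 2015, Theorem 1.1

Topic `Literature/NumberTheory/Sieve`; a companion ("Proofs") file of `ParityWave0.lean` for the
named fact `Literature.NumberTheory.Sieve.frequently_nth_prime_add_le_maynard_tao` (parity.S13, the `m`-tuple form of
bounded gaps), a sibling of `ParityWave0Proofs.lean` (whose section `SmallGaps` treats the case
`m = 1` qualitatively, for GPY's parity.S30, and supplies the Bombieri–Vinogradov bridge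
`Literature.NumberTheory.Sieve.bombieriVinogradovStatement_of_bombieri_vinogradov` used at the end of this file).

## The printed proof, its three deep inputs, and what is proved here

`Literature.NumberTheory.Sieve.frequently_nth_prime_add_le_maynard_tao` (Maynard, *Small gaps between primes*, Ann. of
Math. 181 (2015), Thm 1.1: "Let `m ∈ ℕ`. We have `liminf_n (p_{n+m} − p_n) ≪ m³ e^{4m}`", the
implied constant absolute) is vendored faithfully (`∃ C, ∀ m ≥ 1, ∃ᶠ n, p_{n+m} ≤ p_n + C m³ e^{4m}`;
for an `ℕ`-valued sequence `liminf ≤ B` iff the sequence is `≤ B` infinitely often). Its printed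
proof (§4, p. 8 of arXiv:1311.4600v3, "Finally, we consider the case when `k` is large") rests on
three deep inputs which the tree carries as named facts and which are NOT proved here:

1. the Bombieri–Vinogradov theorem, `Literature.NumberTheory.Sieve.BombieriVinogradovStatement`
   (`Literature/NumberTheory/Sieve/LevelOfDistribution.lean`): level of distribution `x^θ` for
   every `θ < 1/2`;
2. Maynard 2015 Prop. 4.3 (3), `Literature.NumberTheory.Sieve.exists_maynardFunctional_gt`
   (`Literature/NumberTheory/Sieve/MaynardTao.lean`): `M_k > log k − 2 log log k − 2` for `k ≥ k₀`;
3. Maynard 2015 Prop. 4.2 with the conclusion of Thm 3.1,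
   `Literature.NumberTheory.Sieve.frequently_card_primes_ge_of_maynardFunctional` (ibid.): level `θ`, an admissible
   `k`-tuple `H` and an admissible `F` with `(∑ J_k^{(m)}(F))/I_k(F) > 2m/θ` give infinitely many
   `n` with at least `m + 1` primes among the `n + hᵢ`.

Everything else in the printed proof is elementary and is PROVED here, with explicit constants:

* `Literature.NumberTheory.Sieve.frequently_nth_prime_add_le_of_frequently_card` — if for infinitely many `n` at
  least `m + 1` of the `n + h` (`h ∈ H ⊆ [0, D]`) are prime, then `p_{j+m} ≤ p_j + D` for
  infinitely many `j` (the last sentence of Prop. 4.2: `liminf_n (p_{n+r_k−1} − p_n) ≤ max (hᵢ − hⱼ)`);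
* `Literature.NumberTheory.Sieve.nth_prime_le_mul_log` — Chebyshev: `p_n ≤ 45 n log n` for `n ≥ 2` (`0`-indexed
  `Nat.nth Nat.Prime`), from Mathlib's `Chebyshev.pi_ge : 2⁻¹ x / log x ≤ π(x)`;
* Maynard's tuple `H = {p_{π(k)+1}, …, p_{π(k)+k}}` (the explicit `Finset ℤ`
  `(range k).image fun i ↦ p_{π(k)+i}`, `0`-indexed `Nat.nth Nat.Prime`), of
  cardinality `k` (`card_consecutivePrimesTuple`), contained in `(k, p_{2k}]`
  (`mem_consecutivePrimesTuple`) and admissible (`isAdmissibleTuple_consecutivePrimesTuple`, via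
  `isAdmissibleTuple_of_forall_not_dvd`: "no element is a multiple of a prime less than `k`, and
  there are `k` elements, so it cannot cover all residue classes modulo any prime greater than `k`");
* `Literature.NumberTheory.Sieve.lt_log_sub_two_mul_log_log` — for `m ≥ 1` and `x ≥ e^{12} m² e^{4m}`,
  `log x − 2 log log x − 2 > 4m + 1/2` (the printed "`θ M_k / 2 > m` if `k ≥ C m² e^{4m}`", with
  `θ = 4m/(8m+1)`, so that `2m/θ = 4m + 1/2`, in place of Maynard's `θ = 1/2 − 1/k`);
* `Literature.NumberTheory.Sieve.frequently_nth_prime_add_le_maynard_tao_of` — THE ASSEMBLY: inputs 1–3 imply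
  `frequently_nth_prime_add_le_maynard_tao`, with `k = max (k₀, ⌈e^{12} m² e^{4m}⌉)`, `H` as above,
  and `C = 90 A (log (2A) + 6)`, `A = k₀ + 1 + e^{12}` (from `p_{2k} ≤ 90 k log (2k)` and
  `k ≤ A m² e^{4m}`), an absolute constant since `k₀` is.

* `Literature.NumberTheory.Sieve.frequently_nth_prime_add_le_maynard_tao_of_bombieri_vinogradov` — the same assembly
  from the Wave0 form parity.S27 `Literature.NumberTheory.Sieve.bombieri_vinogradov` (level `x^{1/2} (log x)^{−B}` with
  choice functions `y_q ≤ x`) and the two `MaynardTao` facts, input 1 being supplied by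
  `Literature.NumberTheory.Sieve.bombieriVinogradovStatement_of_bombieri_vinogradov` (`ParityWave0Proofs`).

The discharge `frequently_nth_prime_add_le_maynard_tao_holds` is exactly
`frequently_nth_prime_add_le_maynard_tao_of_bombieri_vinogradov` applied to discharges of
parity.S27, Prop. 4.3 (3) and Prop. 4.2, none of which is in Mathlib or in the tree yet
(Bombieri–Vinogradov needs the large sieve, Vaughan's identity and Siegel–Walfisz — see
`BombieriVinogradovFacts.lean`; Prop. 4.2 is the multidimensional Selberg sieve of Maynard §§5–6;
Prop. 4.3 (3) is the variational computation of §7 (§8 of arXiv:1311.4600v3)); it lands when they do.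

## References

* J. Maynard, *Small gaps between primes*, Ann. of Math. (2) 181 (2015), 383–413,
  doi:10.4007/annals.2015.181.1.7 (arXiv:1311.4600v3): Theorem 1.1 (p. 3), Propositions 4.2–4.3
  (p. 7) and the proof of Theorem 1.1 in §4 (p. 8, "Finally, we consider the case when `k` is
  large"). [cite: MaynardAnnals2015]
* D. H. J. Polymath, *Variants of the Selberg sieve, and bounded intervals containing many
  primes*, Res. Math. Sci. 1:12 (2014), arXiv:1407.4897, Claim 2.2 and Theorem 2.3
  (Bombieri–Vinogradov as `EH[ϑ]`, `0 < ϑ < 1/2`). [cite: Polymath8b2014]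
* P. L. Chebyshev, *Mémoire sur les nombres premiers*, J. Math. Pures Appl. 17 (1852), 366–390 —
  `π(x) ≫ x / log x`, here through Mathlib's `Chebyshev.pi_ge`. [folklore]
-/

open Finset

namespace Literature.NumberTheory.Sieve

/-! ## Bounded gaps in `m`-tuples of primes: the assembly of Maynard 2015, Theorem 1.1 -/

section MaynardTao

open Filter Real

/-! ### From many primes in a bounded pattern to small gaps `p_{j+m} − p_j` -/

/-- If for infinitely many `n` at least `m + 1` of the shifts `n + h` (`h ∈ H ⊆ [0, D]`) are prime,
then `p_{j+m} ≤ p_j + D` for infinitely many `j` (take `p_j` the least prime `≥ n`; the `m + 1`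
primes found lie in `[p_j, n + D]`).  This is the step
"`liminf_n (p_{n+r_k-1} − p_n) ≤ max (hᵢ − hⱼ)`" of Maynard 2015, Prop. 4.2.
[cite: MaynardAnnals2015, Proposition 4.2 (last sentence)] -/
theorem frequently_nth_prime_add_le_of_frequently_card {m D : ℕ} {H : Finset ℤ}
    (hH0 : ∀ h ∈ H, (0 : ℤ) ≤ h) (hHD : ∀ h ∈ H, h ≤ (D : ℤ))
    (hfreq : ∃ᶠ n : ℕ in atTop,
      m + 1 ≤ #(H.filter fun h ↦ 0 < (n : ℤ) + h ∧ ((n : ℤ) + h).toNat.Prime)) :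
    ∃ᶠ n in atTop, Nat.nth Nat.Prime (n + m) ≤ Nat.nth Nat.Prime n + D := by
  rw [Filter.frequently_atTop] at hfreq ⊢
  intro N
  obtain ⟨n, hn, hcard⟩ := hfreq (Nat.nth Nat.Prime N)
  set S := H.filter fun h ↦ 0 < (n : ℤ) + h ∧ ((n : ℤ) + h).toNat.Prime with hS
  set T : Finset ℕ := S.image fun h ↦ ((n : ℤ) + h).toNat with hT
  have hTcard : #T = #S := by
    refine Finset.card_image_of_injOn fun a ha b hb hab ↦ ?_
    have ha0 : 0 ≤ (n : ℤ) + a := by have := hH0 a (Finset.mem_filter.1 ha).1; omega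
    have hb0 : 0 ≤ (n : ℤ) + b := by have := hH0 b (Finset.mem_filter.1 hb).1; omega
    have := congrArg (fun t : ℕ ↦ (t : ℤ)) hab
    simp only [Int.toNat_of_nonneg ha0, Int.toNat_of_nonneg hb0] at this
    omega
  have hTmem : ∀ t ∈ T, t.Prime ∧ n ≤ t ∧ t ≤ n + D := by
    intro t ht
    obtain ⟨h, hh, rfl⟩ := Finset.mem_image.1 ht
    obtain ⟨hhH, -, hprime⟩ := Finset.mem_filter.1 hh
    have h0 := hH0 h hhH
    have hD := hHD h hhH
    refine ⟨hprime, ?_, ?_⟩ <;> omega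
  set j := Nat.count Nat.Prime n with hj
  have hnj : n ≤ Nat.nth Nat.Prime j := Nat.le_nth_count Nat.infinite_setOf_prime n
  refine ⟨j, ?_, ?_⟩
  · exact (Nat.nth_le_nth Nat.infinite_setOf_prime).1 (hn.trans hnj)
  · have hlt : j + m < Nat.count Nat.Prime (n + D + 1) := by
      have hsub : (range n).filter Nat.Prime ∪ T ⊆ (range (n + D + 1)).filter Nat.Prime := by
        intro t ht
        rcases Finset.mem_union.1 ht with ht | ht
        · obtain ⟨htn, htp⟩ := Finset.mem_filter.1 ht
          have := Finset.mem_range.1 htn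
          exact Finset.mem_filter.2 ⟨Finset.mem_range.2 (by omega), htp⟩
        · obtain ⟨htp, -, htD⟩ := hTmem t ht
          exact Finset.mem_filter.2 ⟨Finset.mem_range.2 (by omega), htp⟩
      have hdisj : Disjoint ((range n).filter Nat.Prime) T := by
        rw [Finset.disjoint_left]
        intro t ht htT
        have h1 := Finset.mem_range.1 (Finset.mem_filter.1 ht).1
        have h2 := (hTmem t htT).2.1
        omega
      calc j + m < j + #S := by omega
        _ = #((range n).filter Nat.Prime) + #T := by rw [hTcard, hj, Nat.count_eq_card_filter_range]
        _ = #((range n).filter Nat.Prime ∪ T) := (Finset.card_union_of_disjoint hdisj).symm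
        _ ≤ #((range (n + D + 1)).filter Nat.Prime) := Finset.card_le_card hsub
        _ = Nat.count Nat.Prime (n + D + 1) := (Nat.count_eq_card_filter_range _ _).symm
    have := Nat.nth_lt_of_lt_count hlt
    omega

/-! ### Chebyshev: `p_n ≪ n log n` -/

/-- Chebyshev's upper bound for the `n`-th prime with a crude explicit constant:
`p_n ≤ 45 n log n` for `n ≥ 2` (here `p_0 = 2`; Chebyshev 1852, `π(x) ≫ x / log x`; deduced from
Mathlib's `Chebyshev.pi_ge`). [folklore] -/
theorem nth_prime_le_mul_log {n : ℕ} (hn : 2 ≤ n) :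
    (Nat.nth Nat.Prime n : ℝ) ≤ 45 * n * Real.log n := by
  set P := Nat.nth Nat.Prime n with hPdef
  have hP : P.Prime := Nat.prime_nth_prime n
  have hnP : n + 2 ≤ P := Nat.add_two_le_nth_prime n
  have hP4 : (4 : ℝ) ≤ P := by exact_mod_cast (show 4 ≤ P by omega)
  have hn2 : (2 : ℝ) ≤ n := by exact_mod_cast hn
  -- `π(P) = n + 1`
  have hpi : (Nat.primeCounting P : ℝ) = n + 1 := by
    have : Nat.primeCounting P = n + 1 := by
      rw [Nat.primeCounting, Nat.primeCounting', Nat.count_succ, if_pos hP,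
        ← Nat.primeCounting', hPdef, Nat.primeCounting'_nth_eq]
    exact_mod_cast this
  have hcheb := Chebyshev.pi_ge P
  rw [hpi] at hcheb
  have hlogP : Real.log 4 ≤ Real.log P := Real.log_le_log (by norm_num) hP4
  have hlog4 : (1 : ℝ) < Real.log 4 := by
    rw [show (4 : ℝ) = 2 ^ 2 by norm_num, Real.log_pow]
    have := Real.log_two_gt_d9
    push_cast
    linarith
  have hlogPpos : 0 < Real.log P := by linarith
  rw [div_le_iff₀ hlogPpos] at hcheb
  -- `log (P + 1) ≤ log 2 + log P`
  have hlogP1 : Real.log (P + 1) ≤ Real.log 2 + Real.log P := by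
    rw [← Real.log_mul (by norm_num) (by positivity)]
    exact Real.log_le_log (by positivity) (by linarith)
  have hlog2 : (1 / 2 : ℝ) < Real.log 2 := by have := Real.log_two_gt_d9; linarith
  have hlog2' : Real.log 2 ≤ Real.log P := Real.log_le_log (by norm_num) (by linarith)
  -- `P ≤ 5 n log P`
  have h1 : (P : ℝ) ≤ 5 * n * Real.log P := by nlinarith
  -- `log P ≤ 2 √P`, hence `P ≤ 100 n²`
  have hsqrt : Real.log P ≤ 2 * Real.sqrt P := by
    have := Real.log_le_rpow_div (x := (P : ℝ)) (ε := 1 / 2) (by positivity) (by norm_num)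
    rw [← Real.sqrt_eq_rpow] at this
    linarith
  have hPsq : (P : ℝ) = Real.sqrt P * Real.sqrt P := (Real.mul_self_sqrt (by positivity)).symm
  have hsqrtle : Real.sqrt P ≤ 10 * n := by
    have hs : 0 < Real.sqrt P := Real.sqrt_pos.2 (by linarith)
    nlinarith
  have hP100 : (P : ℝ) ≤ 100 * n ^ 2 := by
    have hs : 0 ≤ Real.sqrt P := Real.sqrt_nonneg _
    nlinarith
  -- `log P ≤ 9 log n`
  have hlogn : Real.log 2 ≤ Real.log n := Real.log_le_log (by norm_num) hn2
  have hlogP9 : Real.log P ≤ 9 * Real.log n := by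
    have h100 : Real.log 100 ≤ 7 * Real.log 2 := by
      rw [← Real.log_rpow (by norm_num)]
      exact Real.log_le_log (by norm_num) (by norm_num)
    calc Real.log P ≤ Real.log (100 * n ^ 2) := Real.log_le_log (by positivity) hP100
      _ = Real.log 100 + 2 * Real.log n := by
        rw [Real.log_mul (by norm_num) (by positivity), Real.log_pow]; push_cast; ring
      _ ≤ 9 * Real.log n := by linarith
  have hn0 : (0 : ℝ) ≤ n := by positivity
  calc (P : ℝ) ≤ 5 * n * Real.log P := h1
    _ ≤ 5 * n * (9 * Real.log n) := by gcongr
    _ = 45 * n * Real.log n := by ring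


/-! ### The admissible tuple of `k` consecutive primes exceeding `k` -/

/-- A tuple all of whose members avoid the residue class `0` modulo every prime `p ≤ #H` is
admissible: for `p ≤ #H` the class `0 (mod p)` is missed, and for `p > #H` some class is missed by
counting (`isAdmissibleTuple_iff_of_le_card`). This is the standard remark that any `k` primes
larger than `k` form an admissible `k`-tuple (Maynard 2015, §4, proof of Thm 1.1:
"`H = {p_{π(k)+1}, …, p_{π(k)+k}}` … is an admissible set").
[cite: MaynardAnnals2015, §4, proof of Theorem 1.1] -/
theorem isAdmissibleTuple_of_forall_not_dvd (H : Finset ℤ)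
    (hH : ∀ p : ℕ, p.Prime → p ≤ #H → ∀ h ∈ H, ¬ (p : ℤ) ∣ h) :
    IsAdmissibleTuple H := by
  rw [isAdmissibleTuple_iff_of_le_card]
  intro p hp hpk
  haveI := Fact.mk hp
  unfold tupleResidueCount
  have hsub : H.image (fun h : ℤ ↦ (h : ZMod p)) ⊆ Finset.univ.erase 0 := by
    intro x hx
    obtain ⟨h, hh, rfl⟩ := Finset.mem_image.1 hx
    refine Finset.mem_erase.2 ⟨?_, Finset.mem_univ _⟩
    rw [Ne, ZMod.intCast_zmod_eq_zero_iff_dvd]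
    exact hH p hp hpk h hh
  calc (H.image fun h : ℤ ↦ (h : ZMod p)).card ≤ (Finset.univ.erase (0 : ZMod p)).card :=
      Finset.card_le_card hsub
    _ = p - 1 := by rw [Finset.card_erase_of_mem (Finset.mem_univ _), Finset.card_univ, ZMod.card]
    _ < p := Nat.sub_lt hp.pos one_pos

/-! Maynard's tuple `H = {p_{π(k)+1}, …, p_{π(k)+k}}` of the `k` smallest primes exceeding `k`
(Maynard 2015, §4, proof of Thm 1.1) is written with Mathlib's `0`-indexed `Nat.nth Nat.Prime` as
the `Finset ℤ` image `(range k).image fun i ↦ p_{π(k)+i}`, i.e.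
`(range k).image fun i : ℕ ↦ ((Nat.nth Nat.Prime (Nat.primeCounting k + i) : ℕ) : ℤ)`; it is kept
as an explicit term (no auxiliary definition) in the three lemmas below and in the assembly. -/

/-- `H = {p_{π(k)+1}, …, p_{π(k)+k}}` has exactly `k` members ("there are `k` elements", Maynard
2015, §4, proof of Thm 1.1; `Nat.nth Nat.Prime` is strictly monotone).
[cite: MaynardAnnals2015, §4, proof of Theorem 1.1] -/
theorem card_consecutivePrimesTuple (k : ℕ) :
    #((range k).image fun i : ℕ ↦
      ((Nat.nth Nat.Prime (Nat.primeCounting k + i) : ℕ) : ℤ)) = k := by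
  rw [Finset.card_image_of_injective _ fun i j hij ↦ ?_, Finset.card_range]
  have := (Nat.nth_strictMono Nat.infinite_setOf_prime).injective (Int.ofNat_injective hij)
  omega

/-- Members of `H = {p_{π(k)+1}, …, p_{π(k)+k}}` are primes `q` with `k < q ≤ p_{2k}` (the upper
index `0`-indexed as in `Nat.nth`; `π(k) ≤ k + 1` by `Nat.count_le`). This carries the two facts used
in Maynard 2015, §4, proof of Thm 1.1: no member is a multiple of a prime `≤ k`, and the diameter is
`≤ p_{k+π(k)} ≪ k log k`. [cite: MaynardAnnals2015, §4, proof of Theorem 1.1] -/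
theorem mem_consecutivePrimesTuple {k : ℕ} {h : ℤ}
    (hh : h ∈ (range k).image fun i : ℕ ↦
      ((Nat.nth Nat.Prime (Nat.primeCounting k + i) : ℕ) : ℤ)) :
    ∃ q : ℕ, q.Prime ∧ k < q ∧ q ≤ Nat.nth Nat.Prime (2 * k) ∧ h = q := by
  obtain ⟨i, hi, rfl⟩ := Finset.mem_image.1 hh
  rw [Finset.mem_range] at hi
  refine ⟨_, Nat.prime_nth_prime _, ?_, ?_, rfl⟩
  · have h1 : k + 1 ≤ Nat.nth Nat.Prime (Nat.primeCounting k) :=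
      Nat.le_nth_count Nat.infinite_setOf_prime (k + 1)
    have h2 : Nat.nth Nat.Prime (Nat.primeCounting k) ≤
        Nat.nth Nat.Prime (Nat.primeCounting k + i) :=
      (Nat.nth_le_nth Nat.infinite_setOf_prime).2 (Nat.le_add_right _ _)
    omega
  · refine (Nat.nth_le_nth Nat.infinite_setOf_prime).2 ?_
    have : Nat.primeCounting k ≤ k + 1 := Nat.count_le _
    omega

/-- `H = {p_{π(k)+1}, …, p_{π(k)+k}}` is admissible (Maynard 2015, §4, proof of Thm 1.1): its
members are primes `> k = #H`, so no prime `p ≤ k` divides any of them.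
[cite: MaynardAnnals2015, §4, proof of Theorem 1.1] -/
theorem isAdmissibleTuple_consecutivePrimesTuple (k : ℕ) :
    IsAdmissibleTuple ((range k).image fun i : ℕ ↦
      ((Nat.nth Nat.Prime (Nat.primeCounting k + i) : ℕ) : ℤ)) := by
  refine isAdmissibleTuple_of_forall_not_dvd _ fun p hp hpk h hh hdvd ↦ ?_
  rw [card_consecutivePrimesTuple] at hpk
  obtain ⟨q, hq, hkq, -, rfl⟩ := mem_consecutivePrimesTuple hh
  have hpq : p ∣ q := by exact_mod_cast hdvd
  have := (Nat.prime_dvd_prime_iff_eq hp hq).1 hpq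
  omega

/-! ### The numerical inequality behind the choice `k ≈ m² e^{4m}` -/

/-- For `m ≥ 1` and `x ≥ e^{12} m² e^{4m}` one has `log x − 2 log log x − 2 > 4m + 1/2`
(the verification, with explicit constants, of "`M_k > 2m/θ` if `k ≥ C m² e^{4m}`" in Maynard 2015,
§4, proof of Thm 1.1, given Prop. 4.3 (3) `M_k > log k − 2 log log k − 2`). Elementary:
with `u = 12 + 2 log m + 4m ≤ log x` one has `2 log log x ≤ 2 log u + (log x − u)` (from
`log t ≤ t − 1` and `u ≥ 2`) and `u ≤ 16 m`.
[cite: MaynardAnnals2015, §4, proof of Theorem 1.1] -/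
theorem lt_log_sub_two_mul_log_log {m : ℕ} (hm : 1 ≤ m) {x : ℝ}
    (hx : Real.exp 12 * (m : ℝ) ^ 2 * Real.exp (4 * m) ≤ x) :
    4 * (m : ℝ) + 1 / 2 < Real.log x - 2 * Real.log (Real.log x) - 2 := by
  have hm1 : (1 : ℝ) ≤ m := by exact_mod_cast hm
  have hm0 : (0 : ℝ) < m := by linarith
  set u : ℝ := 12 + 2 * Real.log m + 4 * m with hu
  have hx0 : 0 < Real.exp 12 * (m : ℝ) ^ 2 * Real.exp (4 * m) := by positivity
  have hlogx0 : Real.log (Real.exp 12 * (m : ℝ) ^ 2 * Real.exp (4 * m)) = u := by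
    rw [Real.log_mul (by positivity) (by positivity), Real.log_mul (by positivity) (by positivity),
      Real.log_exp, Real.log_exp, Real.log_pow]
    push_cast
    ring
  have huv : u ≤ Real.log x := hlogx0 ▸ Real.log_le_log hx0 hx
  set v := Real.log x with hv
  have hlogm0 : 0 ≤ Real.log m := Real.log_nonneg hm1
  have hlogm : Real.log m ≤ m - 1 := Real.log_le_sub_one_of_pos hm0
  have hu2 : 2 ≤ u := by linarith
  have hu16 : u ≤ 16 * m := by linarith
  have hu0 : 0 < u := by linarith
  -- `2 log v ≤ 2 log u + (v - u)`
  have h1 : Real.log v ≤ Real.log u + (v - u) / 2 := by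
    have hv0 : 0 < v := by linarith
    have hvu : Real.log (v / u) ≤ v / u - 1 := Real.log_le_sub_one_of_pos (div_pos hv0 hu0)
    rw [Real.log_div (by linarith) hu0.ne'] at hvu
    have : v / u - 1 = (v - u) / u := by field_simp
    rw [this] at hvu
    have h3 : (v - u) / u ≤ (v - u) / 2 := by
      rw [div_le_div_iff₀ hu0 two_pos]
      nlinarith
    linarith
  -- `log u ≤ log 16 + log m < 2.78 + log m`
  have h2 : Real.log u ≤ 4 * Real.log 2 + Real.log m := by
    have : Real.log (16 * m) = 4 * Real.log 2 + Real.log m := by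
      rw [Real.log_mul (by norm_num) hm0.ne', show (16 : ℝ) = 2 ^ 4 by norm_num, Real.log_pow]
      push_cast; ring
    rw [← this]
    exact Real.log_le_log hu0 hu16
  have hlog2 : Real.log 2 < 0.6931471808 := Real.log_two_lt_d9
  linarith

/-! ### Assembly: Maynard 2015, Thm 1.1 from Bombieri–Vinogradov, Prop. 4.2 and Prop. 4.3 (3) -/

/-- **Maynard 2015, Thm 1.1, the assembly (§4, "Finally, we consider the case when `k` is
large").** Assume (i) the Bombieri–Vinogradov theorem in level-of-distribution form
(`BombieriVinogradovStatement`: level `x^θ` for every `θ < 1/2`), (ii) Prop. 4.3 (3)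
(`exists_maynardFunctional_gt`: `M_k > log k − 2 log log k − 2` for `k ≥ k₀`) and (iii) Prop. 4.2
with the conclusion of Thm 3.1 (`frequently_card_primes_ge_of_maynardFunctional`). Then there is an
absolute `C` with `liminf_n (p_{n+m} − p_n) ≤ C m³ e^{4m}` for every `m ≥ 1`. Proof as printed:
take `θ = 4m/(8m+1) < 1/2` (so `2m/θ = 4m + 1/2`) and `k = max(k₀, ⌈e^{12} m² e^{4m}⌉)`; then
`M_k > log k − 2 log log k − 2 > 4m + 1/2 = 2m/θ` (`lt_log_sub_two_mul_log_log`), the tuple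
`H = {p_{π(k)+1}, …, p_{π(k)+k}}` is admissible (`isAdmissibleTuple_consecutivePrimesTuple`) and
lies in `[0, p_{2k}]`, so at least `m + 1` of the `n + hᵢ` are prime for infinitely many `n`, whence
`p_{j+m} ≤ p_j + p_{2k}` infinitely often (`frequently_nth_prime_add_le_of_frequently_card`), and
`p_{2k} ≤ 90 k log (2k) ≤ 90 A (log (2A) + 6) m³ e^{4m}` with `A = k₀ + 1 + e^{12}` by Chebyshev
(`nth_prime_le_mul_log`). The constant `C = 90 A (log (2A) + 6)` depends only on the absolute `k₀` of
Prop. 4.3 (3). [cite: MaynardAnnals2015, Theorem 1.1 and §4 (proof of Theorem 1.1)] -/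
theorem frequently_nth_prime_add_le_maynard_tao_of (hBV : BombieriVinogradovStatement)
    (hM : exists_maynardFunctional_gt) (hS : frequently_card_primes_ge_of_maynardFunctional) :
    frequently_nth_prime_add_le_maynard_tao := by
  obtain ⟨k₀, hk₀⟩ := hM
  -- the absolute constant
  set A : ℝ := k₀ + 1 + Real.exp 12 with hA
  have hA1 : 1 ≤ A := by
    have := Real.exp_pos 12
    rw [hA]; linarith [(Nat.cast_nonneg k₀ : (0 : ℝ) ≤ k₀)]
  have hlog2A : 0 ≤ Real.log (2 * A) := Real.log_nonneg (by linarith)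
  refine ⟨90 * A * (Real.log (2 * A) + 6), fun m hm ↦ ?_⟩
  have hm1 : (1 : ℝ) ≤ m := by exact_mod_cast hm
  -- the size `E = m² e^{4m}` and the parameter `k`
  set E : ℝ := (m : ℝ) ^ 2 * Real.exp (4 * m) with hE
  have hE1 : 1 ≤ E := by
    have h1 : (1 : ℝ) ≤ (m : ℝ) ^ 2 := by nlinarith
    have h2 : (1 : ℝ) ≤ Real.exp (4 * m) := Real.one_le_exp (by positivity)
    nlinarith
  set x₀ : ℝ := Real.exp 12 * (m : ℝ) ^ 2 * Real.exp (4 * m) with hx₀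
  have hx₀E : x₀ = Real.exp 12 * E := by rw [hx₀, hE]; ring
  have hx₀0 : 0 ≤ x₀ := by positivity
  set k : ℕ := max k₀ ⌈x₀⌉₊ with hk
  have hkk₀ : k₀ ≤ k := le_max_left _ _
  have hx₀k : x₀ ≤ k := (Nat.le_ceil x₀).trans (by exact_mod_cast le_max_right _ _)
  have hk1' : (1 : ℝ) ≤ k := by
    have : (1 : ℝ) ≤ Real.exp 12 := Real.one_le_exp (by norm_num)
    nlinarith
  have hk1 : 1 ≤ k := by exact_mod_cast hk1'
  have hkA : (k : ℝ) ≤ A * E := by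
    have h1 : k ≤ k₀ + ⌈x₀⌉₊ := max_le_add_of_nonneg (Nat.zero_le _) (Nat.zero_le _)
    have h1' : (k : ℝ) ≤ k₀ + ⌈x₀⌉₊ := by exact_mod_cast h1
    have h2 : (⌈x₀⌉₊ : ℝ) < x₀ + 1 := Nat.ceil_lt_add_one hx₀0
    have h3 : ((k₀ : ℝ) + 1) * 1 ≤ ((k₀ : ℝ) + 1) * E :=
      mul_le_mul_of_nonneg_left hE1 (by positivity)
    have h4 : A * E = ((k₀ : ℝ) + 1) * E + Real.exp 12 * E := by rw [hA]; ring
    linarith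
  -- Prop. 4.3 (3) at `k`, and the level `θ = 4m/(8m+1)`
  obtain ⟨F, hF, hFgt⟩ := hk₀ k hkk₀
  set θ : ℝ := 4 * m / (8 * m + 1) with hθ
  have hθ0 : 0 < θ := by positivity
  have hθhalf : θ < 1 / 2 := by rw [hθ, div_lt_iff₀ (by positivity)]; linarith
  have h2mθ : 2 * (m : ℝ) / θ = 4 * m + 1 / 2 := by
    rw [hθ]; field_simp; ring
  have hMk : 2 * (m : ℝ) / θ < maynardFunctional k F := by
    rw [h2mθ]
    exact (lt_log_sub_two_mul_log_log hm hx₀k).trans hFgt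
  -- Prop. 4.2 for `H = {p_{π(k)+1}, …, p_{π(k)+k}}`, then the combinatorial step with `D = p_{2k}`
  have hfreq := hS θ hθ0 (hBV θ hθhalf) m k F hF hMk _
    (isAdmissibleTuple_consecutivePrimesTuple k) (card_consecutivePrimesTuple k)
  have hgap : ∃ᶠ n in atTop,
      Nat.nth Nat.Prime (n + m) ≤ Nat.nth Nat.Prime n + Nat.nth Nat.Prime (2 * k) := by
    refine frequently_nth_prime_add_le_of_frequently_card (fun h hh ↦ ?_) (fun h hh ↦ ?_) hfreq
    · obtain ⟨q, -, -, -, rfl⟩ := mem_consecutivePrimesTuple hh; positivity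
    · obtain ⟨q, -, -, hq, rfl⟩ := mem_consecutivePrimesTuple hh; exact_mod_cast hq
  -- Chebyshev: `p_{2k} ≤ 90 k log (2k) ≤ C m³ e^{4m}`
  have hD : (Nat.nth Nat.Prime (2 * k) : ℝ) ≤
      90 * A * (Real.log (2 * A) + 6) * (m : ℝ) ^ 3 * Real.exp (4 * m) := by
    have h1 : (Nat.nth Nat.Prime (2 * k) : ℝ) ≤ 45 * (2 * k) * Real.log (2 * k) := by
      have := nth_prime_le_mul_log (n := 2 * k) (by omega)
      push_cast at this
      exact this
    have hlogm : Real.log m ≤ m - 1 := Real.log_le_sub_one_of_pos (by positivity)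
    have h2 : Real.log (2 * k) ≤ (Real.log (2 * A) + 6) * m := by
      have h21 : Real.log (2 * k) ≤ Real.log (2 * A * ((m : ℝ) ^ 2 * Real.exp (4 * m))) :=
        Real.log_le_log (by positivity) (by rw [← hE]; nlinarith)
      have h22 : Real.log (2 * A * ((m : ℝ) ^ 2 * Real.exp (4 * m))) =
          Real.log (2 * A) + 2 * Real.log m + 4 * m := by
        have hE' : Real.log ((m : ℝ) ^ 2 * Real.exp (4 * m)) = 2 * Real.log m + 4 * m := by
          rw [Real.log_mul (by positivity) (by positivity), Real.log_pow, Real.log_exp]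
          push_cast; ring
        rw [Real.log_mul (by positivity) (by positivity), hE']; ring
      have h23 : Real.log (2 * A) * 1 ≤ Real.log (2 * A) * m :=
        mul_le_mul_of_nonneg_left hm1 hlog2A
      linarith
    have hlog2k : 0 ≤ Real.log (2 * k) := Real.log_nonneg (by linarith)
    calc (Nat.nth Nat.Prime (2 * k) : ℝ) ≤ 45 * (2 * k) * Real.log (2 * k) := h1
      _ ≤ 45 * (2 * (A * E)) * ((Real.log (2 * A) + 6) * m) := by
        apply mul_le_mul _ h2 hlog2k (by positivity)
        linarith
      _ = 90 * A * (Real.log (2 * A) + 6) * (m : ℝ) ^ 3 * Real.exp (4 * m) := by rw [hE]; ring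
  refine hgap.mono fun n hn ↦ ?_
  have hn' : (Nat.nth Nat.Prime (n + m) : ℝ) ≤
      Nat.nth Nat.Prime n + Nat.nth Nat.Prime (2 * k) := by exact_mod_cast hn
  linarith

end MaynardTao


/-! ## Maynard's Theorem 1.1 from the Wave0 facts (parity.S27 for Bombieri–Vinogradov) -/

section BombieriVinogradov

/-- **Maynard 2015, Thm 1.1 from the Wave0 facts.** The named fact
`frequently_nth_prime_add_le_maynard_tao` follows from parity.S27 (`bombieri_vinogradov`, the
Bombieri–Vinogradov theorem as vendored in `ParityWave0`), Maynard 2015 Prop. 4.3 (3)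
(`Literature.NumberTheory.Sieve.exists_maynardFunctional_gt`) and Prop. 4.2 with the conclusion of Thm 3.1
(`Literature.NumberTheory.Sieve.frequently_card_primes_ge_of_maynardFunctional`):
`bombieriVinogradovStatement_of_bombieri_vinogradov` feeds
`frequently_nth_prime_add_le_maynard_tao_of`. Its discharge is this term applied to the discharges
of the three facts. [cite: MaynardAnnals2015, Theorem 1.1 and §4 (proof of Theorem 1.1)] -/
theorem frequently_nth_prime_add_le_maynard_tao_of_bombieri_vinogradov (hBV : bombieri_vinogradov)
    (hM : exists_maynardFunctional_gt) (hS : frequently_card_primes_ge_of_maynardFunctional) :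
    frequently_nth_prime_add_le_maynard_tao :=
  frequently_nth_prime_add_le_maynard_tao_of
    (bombieriVinogradovStatement_of_bombieri_vinogradov hBV) hM hS

end BombieriVinogradov

end Literature.NumberTheory.Sieve
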